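import Summits.AtomisticToContinuum.BoseEinsteinCondensation.Theorems.BECCutLineWeakDisorderAcrossCutDefs
import Summits.AtomisticToContinuum.BoseEinsteinCondensation.Theorems.BECCutLineWeakDisorderTwoReplicaTransienceBoundTracerMeasurable
import Summits.AtomisticToContinuum.BoseEinsteinCondensation.Theorems.BECCutLineWeakDisorderTwoReplicaTransienceBoundFactorisation
import Literature.MathematicalPhysics.QuantumManyBody.GroundStateFeynmanKacSemigroup
import HarnessLib

/-!
# Crux `TwoReplicaTransienceBound` (stmt-AtomisticToContinuum-9687), line `across-cut-thinning` v2: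
# from the pathwise four-point inequality to the annealed BLOCK two-replica bound (`stub_blockOfFourPoint`)

Support file (`--supports stmt-AtomisticToContinuum-9687`, lead c6; second half of the registered stub
`stub_blockOfCovariance : TiltFTC → BlockOfCovarianceReduction`). For measurable `v`, `T ≥ 0` and a
constant `c ∈ [0,∞]`: IF `Λ(1,1)·Λ(0,0) ≤ c·Λ(1,0)·Λ(0,1)` for ALL junction pairs `x, x'` and ALL
frozen tagged path pairs `ω₀, ω₀'` (`crossFull · bathTwo ≤ c · crossHalf · crossHalf'`), THEN for
every dyadic block `Q = (j, i)`

  `(∫ Z_n² dY) · ∫ A_Q(Y)² dY ≤ c · (∫ A_Q Z_n dY)²`  (`bathTwo · ∫ blockAmp² ≤ c · meanAmp²`).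

Proof (Tonelli through the tracer factorisation, no analysis): by `stub_factorisation` (landed) and
the definition of the tracer, `Z_{n+1}(x::Y) = ∫ dW_L(ω₀) 𝟙_{surv}(x,ω₀) · E_Y[w e^{-A(x,ω₀)}]`, so the
block insertion amplitude is `A_Q(Y) = ∫_P 𝟙_{surv}(p) · sideWeight(p, Y) dP(p)` over the tagged
half-line space `P = (dx on Q) ⊗ W_L` (`blockAmp_eq_lintegral_taggedHalf`); hence
`∫ A_Q² dY = ∫_{P×P} 𝟙𝟙' · crossFull(p,p')` and `∫ A_Q Z_n dY = ∫_P 𝟙 · crossHalf(p)` (Tonelli,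
`lintegral_prod_mul`, `lintegral_lintegral_swap`), and the hypothesis integrates. The measurability
inputs are the joint measurability of the Feynman–Kac weight (`measurable_fkWeight_uncurry`), of the
tagged–bath action (`TracerMeasurability.measurable_taggedBathIntegrand`) and of the tagged survival
indicator (`TracerMeasurability.measurable_taggedIndicator`).
-/

noncomputable section

open MeasureTheory Filter Set Finset
open scoped ENNReal NNReal Topology BigOperators

namespace Summit.AtomisticToContinuum.BoseEinsteinCondensation.Cruxes.TwoReplicaTransienceBound.AcrossCutThinning

open Literature.MathematicalPhysics.QuantumManyBody.BoseGas
open Summit.AtomisticToContinuum.BoseEinsteinCondensation.Cruxes.TwoReplicaTransienceBound.TracerDecoupling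
open Summit.AtomisticToContinuum.BoseEinsteinCondensation.Cruxes.TwoReplicaTransienceBound.TracerDecoupling.TracerMeasurability
open Summit.AtomisticToContinuum.BoseEinsteinCondensation.Cruxes.LandscapeBound.SiblingTelescopingChaining

variable {n : ℕ}

/-- A tagged half-line datum: junction `x` and frozen tagged path `ω₀`. -/
abbrev TaggedHalf : Type := Space × (Fin 3 → (ℝ≥0 → ℝ))

namespace BlockReduction

variable {v : ℝ → ℝ≥0∞} {L T : ℝ}

/-! ### The tagged survival indicator and the joint measurability of the side weight -/

/-- The tagged survival indicator `𝟙{x + √2 b(ω₀) stays in Λ_L on [0,T]}` of a half-line datum. -/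
def survInd (L T : ℝ) (p : TaggedHalf) : ℝ≥0∞ :=
  (survives (N := 1) L T (fun _ => p.1)).indicator (fun _ => (1 : ℝ≥0∞)) (fun _ => p.2)

/-- `𝟙 ≤ 1`. -/
theorem survInd_le_one (L T : ℝ) (p : TaggedHalf) : survInd L T p ≤ 1 :=
  Set.indicator_le_self' (fun _ _ => bot_le) _

/-- The tagged survival indicator is measurable in the half-line datum. -/
theorem measurable_survInd (L T : ℝ) : Measurable (survInd L T) := by
  have hι : Measurable fun p : TaggedHalf =>
      (((p.1, (fun _ _ _ => 0 : PathSpace 0)) : Space × PathSpace 0), p.2) :=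
    (measurable_fst.prodMk measurable_const).prodMk measurable_snd
  have h := (measurable_taggedIndicator (n := 0) L T).comp hι
  exact h

/-- **Joint measurability of the side integrand** `((Y, (x, ω₀)), ωb) ↦ w(Y,ωb) · e^{-A(x,Y,ω₀,ωb)}`. -/
theorem measurable_sideIntegrand (hv : Measurable v) (L T : ℝ) :
    Measurable fun r : (Config n × TaggedHalf) × PathSpace n =>
      fkWeight v L T r.1.1 r.2 * expNeg (taggedBathAction v T r.1.2.1 r.1.1 r.1.2.2 r.2) := by
  -- the weight
  have hπw : Measurable fun r : (Config n × TaggedHalf) × PathSpace n => (r.1.1, r.2) :=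
    (measurable_fst.comp measurable_fst).prodMk measurable_snd
  have hw' := (measurable_fkWeight_uncurry (N := n) hv L T).comp hπw
  have hw : Measurable fun r : (Config n × TaggedHalf) × PathSpace n => fkWeight v L T r.1.1 r.2 := hw'
  -- the action: integrand measurable in (parameter, time), then Tonelli measurability
  have hπX : Measurable fun a : ((Config n × TaggedHalf) × PathSpace n) × ℝ => (a.1.1.2.1, a.1.1.1) :=
    ((measurable_fst.comp (measurable_snd.comp measurable_fst)).comp measurable_fst).prodMk
      ((measurable_fst.comp measurable_fst).comp measurable_fst)
  have hX' := measurable_vecCons.comp hπX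
  have hX : Measurable fun a : ((Config n × TaggedHalf) × PathSpace n) × ℝ =>
      (Matrix.vecCons a.1.1.2.1 a.1.1.1 : Config (n + 1)) := hX'
  have hω : Measurable fun a : ((Config n × TaggedHalf) × PathSpace n) × ℝ =>
      (Fin.cons a.1.1.2.2 a.1.2 : PathSpace (n + 1)) :=
    measurable_finCons ((measurable_snd.comp (measurable_snd.comp measurable_fst)).comp measurable_fst)
      (measurable_snd.comp measurable_fst)
  have hI := measurable_taggedBathIntegrand hv hX hω measurable_snd
  have hA : Measurable fun r : (Config n × TaggedHalf) × PathSpace n =>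
      taggedBathAction v T r.1.2.1 r.1.1 r.1.2.2 r.2 := by
    unfold taggedBathAction
    exact hI.lintegral_prod_right'
  exact hw.mul (measurable_expNeg.comp hA)

/-- Joint measurability of the side weight `(Y, (x, ω₀)) ↦ sideWeight v L T x Y ω₀`. -/
theorem measurable_sideWeight₂ (hv : Measurable v) (L T : ℝ) :
    Measurable fun q : Config n × TaggedHalf => sideWeight v L T q.2.1 q.1 q.2.2 := by
  unfold sideWeight
  exact (measurable_sideIntegrand hv L T).lintegral_prod_right'

/-- Measurability of the side weight in the half-line datum, at a fixed slice. -/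
theorem measurable_sideWeight_tagged (hv : Measurable v) (L T : ℝ) (Y : Config n) :
    Measurable fun p : TaggedHalf => sideWeight v L T p.1 Y p.2 := by
  have hι : Measurable fun p : TaggedHalf => ((Y, p) : Config n × TaggedHalf) :=
    measurable_const.prodMk measurable_id
  have h := (measurable_sideWeight₂ (n := n) hv L T).comp hι
  exact h

/-- Measurability of the side weight in the slice, at a fixed half-line datum. -/
theorem measurable_sideWeight_slice (hv : Measurable v) (L T : ℝ) (p : TaggedHalf) :
    Measurable fun Y : Config n => sideWeight v L T p.1 Y p.2 := by
  have hι : Measurable fun Y : Config n => ((Y, p) : Config n × TaggedHalf) :=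
    measurable_id.prodMk measurable_const
  have h := (measurable_sideWeight₂ (n := n) hv L T).comp hι
  exact h

/-- Joint measurability of `crossFull` in the pair of half-line data. -/
theorem measurable_crossFull₂ (hv : Measurable v) (L T : ℝ) :
    Measurable fun pp : TaggedHalf × TaggedHalf =>
      crossFull (n := n) v L T pp.1.1 pp.1.2 pp.2.1 pp.2.2 := by
  have hs := measurable_sideWeight₂ (n := n) hv L T
  have hι₁ : Measurable fun r : (TaggedHalf × TaggedHalf) × Config n => ((r.2, r.1.1) : Config n × TaggedHalf) :=
    measurable_snd.prodMk (measurable_fst.comp measurable_fst)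
  have hι₂ : Measurable fun r : (TaggedHalf × TaggedHalf) × Config n => ((r.2, r.1.2) : Config n × TaggedHalf) :=
    measurable_snd.prodMk (measurable_snd.comp measurable_fst)
  have hF' := (hs.comp hι₁).mul (hs.comp hι₂)
  have hF : Measurable fun r : (TaggedHalf × TaggedHalf) × Config n =>
      sideWeight v L T r.1.1.1 r.2 r.1.1.2 * sideWeight v L T r.1.2.1 r.2 r.1.2.2 := hF'
  unfold crossFull
  exact hF.lintegral_prod_right'

/-- Measurability of `crossHalf` in the half-line datum. -/
theorem measurable_crossHalf₁ (hv : Measurable v) (L T : ℝ) :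
    Measurable fun p : TaggedHalf => crossHalf (n := n) v L T p.1 p.2 := by
  have hs := measurable_sideWeight₂ (n := n) hv L T
  have hι : Measurable fun r : TaggedHalf × Config n => ((r.2, r.1) : Config n × TaggedHalf) :=
    measurable_snd.prodMk measurable_fst
  have hZ₀ : Measurable fun Y : Config n => fkPartition v L T Y :=
    measurable_fkSemigroup hv L T measurable_const
  have hZ : Measurable fun r : TaggedHalf × Config n => fkPartition v L T r.2 :=
    hZ₀.comp measurable_snd
  have hF' := (hs.comp hι).mul hZ
  have hF : Measurable fun r : TaggedHalf × Config n =>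
      sideWeight v L T r.1.1 r.2 r.1.2 * fkPartition v L T r.2 := hF'
  unfold crossHalf
  exact hF.lintegral_prod_right'

/-! ### The block insertion amplitude as an integral over the tagged half-line space -/

/-- The tagged half-line space of the block `Q`: `(dx on Q) ⊗ W_L(dω₀)` (reducible, so that the
`SFinite` instance of the product is found). -/
abbrev halfSpace (L : ℝ) (j : ℕ) (i : Fin 3 → Fin (2 ^ j)) : Measure TaggedHalf :=
  ((volume : Measure Space).restrict (dyadicCube L j i)).prod wienerLine

/-- **The insertion profile through the tracer**:
`Z_{n+1}(x::Y) = ∫ 𝟙_{surv}(x,ω₀) · sideWeight(x, Y, ω₀) dW_L(ω₀)` (factorisation + Tonelli). -/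
theorem partSlice_eq_lintegral_sideWeight (hv : Measurable v) (L T : ℝ) (Y : Config n) (x : Space) :
    partSlice v L T Y x = ∫⁻ ω₀, survInd L T (x, ω₀) * sideWeight v L T x Y ω₀ ∂wienerLine := by
  unfold partSlice
  rw [stub_factorisation n v hv L T x Y]
  -- `∫ w(ωb) (∫ 𝟙 e^{-A} dω₀) dωb = ∫∫ w 𝟙 e^{-A}`, swap, pull `𝟙` out
  have hI := measurable_tracerIntegrand (n := n) hv L T Y
  have hι : Measurable fun q : PathSpace n × (Fin 3 → (ℝ≥0 → ℝ)) =>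
      (((x, q.1) : Space × PathSpace n), q.2) := (measurable_const.prodMk measurable_fst).prodMk measurable_snd
  have hJ' := hI.comp hι
  have hJ : Measurable fun q : PathSpace n × (Fin 3 → (ℝ≥0 → ℝ)) =>
      survInd L T (x, q.2) * expNeg (taggedBathAction v T x Y q.2 q.1) := hJ'
  have hw : Measurable fun q : PathSpace n × (Fin 3 → (ℝ≥0 → ℝ)) => fkWeight v L T Y q.1 :=
    (measurable_fkWeight hv L T Y).comp measurable_fst
  have hK := hw.mul hJ
  calc ∫⁻ ωb, fkWeight v L T Y ωb * tracer v L T x Y ωb ∂wienerPaths n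
      = ∫⁻ ωb, ∫⁻ ω₀, fkWeight v L T Y ωb *
          (survInd L T (x, ω₀) * expNeg (taggedBathAction v T x Y ω₀ ωb)) ∂wienerLine ∂wienerPaths n := by
        refine lintegral_congr fun ωb => ?_
        rw [tracer_def, ← lintegral_const_mul' _ _ (fkWeight_ne_top v L T Y ωb)]
        rfl
    _ = ∫⁻ ω₀, ∫⁻ ωb, fkWeight v L T Y ωb *
          (survInd L T (x, ω₀) * expNeg (taggedBathAction v T x Y ω₀ ωb)) ∂wienerPaths n ∂wienerLine :=
        lintegral_lintegral_swap hK.aemeasurable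
    _ = ∫⁻ ω₀, survInd L T (x, ω₀) * sideWeight v L T x Y ω₀ ∂wienerLine := by
        refine lintegral_congr fun ω₀ => ?_
        have hc : survInd L T (x, ω₀) ≠ ⊤ :=
          ne_top_of_le_ne_top ENNReal.one_ne_top (survInd_le_one L T _)
        rw [sideWeight, ← lintegral_const_mul' _ _ hc]
        refine lintegral_congr fun ωb => ?_
        ring

/-- **The block insertion amplitude over the tagged half-line space**:
`A_Q(Y) = ∫_P 𝟙_{surv}(p) · sideWeight(p, Y) dP(p)`. -/
theorem blockAmp_eq_lintegral_halfSpace (hv : Measurable v) (L T : ℝ) (j : ℕ) (i : Fin 3 → Fin (2 ^ j))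
    (Y : Config n) :
    blockAmp v L T j i Y = ∫⁻ p, survInd L T p * sideWeight v L T p.1 Y p.2 ∂halfSpace L j i := by
  have hF : Measurable fun p : TaggedHalf => survInd L T p * sideWeight v L T p.1 Y p.2 :=
    (measurable_survInd L T).mul (measurable_sideWeight_tagged hv L T Y)
  unfold blockAmp blockMass halfSpace
  rw [lintegral_prod _ hF.aemeasurable]
  refine setLIntegral_congr_fun (measurableSet_dyadicCube L j i) (fun x _ => ?_)
  exact partSlice_eq_lintegral_sideWeight hv L T Y x

end BlockReduction

open BlockReduction

/-! ### The block two-replica bound from the four-point inequality -/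

namespace Goal

/-- Registered toolbox stub `stub_blockOfFourPoint` (second half of `stub_blockOfCovariance`): the
pathwise four-point inequality for all junction/path pairs implies the annealed block two-replica
bound for every dyadic block. -/
abbrev stub_blockOfFourPoint : Prop :=
  ∀ (n : ℕ) (v : ℝ → ℝ≥0∞), Measurable v → ∀ (L T : ℝ) (c : ℝ≥0∞),
    (∀ (x x' : Space) (ω₀ ω₀' : Fin 3 → (ℝ≥0 → ℝ)),
      crossFull (n := n) v L T x ω₀ x' ω₀' * bathTwo v L T n ≤
        c * (crossHalf (n := n) v L T x ω₀ * crossHalf (n := n) v L T x' ω₀')) →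
    ∀ (j : ℕ) (i : Fin 3 → Fin (2 ^ j)),
      bathTwo v L T n * ∫⁻ Y : Config n, blockAmp v L T j i Y ^ 2 ≤ c * meanAmp v L T j i n ^ 2

end Goal

/-- **The annealed block two-replica bound from the pathwise four-point inequality** (toolbox stub
`stub_blockOfFourPoint`, see the module docstring). -/
theorem stub_blockOfFourPoint : Goal.stub_blockOfFourPoint := by
  intro n v hv L T c h4 j i
  set P := halfSpace L j i with hPdef
  -- the integrand `F(Y, p) = 𝟙(p) · sideWeight(p, Y)` and its measurability
  set F : Config n → TaggedHalf → ℝ≥0∞ := fun Y p => survInd L T p * sideWeight v L T p.1 Y p.2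
    with hFdef
  have hF₂' := ((measurable_survInd L T).comp
      (measurable_snd : Measurable fun q : Config n × TaggedHalf => q.2)).mul
    (measurable_sideWeight₂ (n := n) hv L T)
  have hF₂ : Measurable fun q : Config n × TaggedHalf => F q.1 q.2 := hF₂'
  have hFY : ∀ Y : Config n, Measurable (F Y) := fun Y =>
    (measurable_survInd L T).mul (measurable_sideWeight_tagged hv L T Y)
  have hA : ∀ Y : Config n, blockAmp v L T j i Y = ∫⁻ p, F Y p ∂P := fun Y =>
    blockAmp_eq_lintegral_halfSpace hv L T j i Y
  have hcH := measurable_crossHalf₁ (n := n) hv L T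
  have hcF := measurable_crossFull₂ (n := n) hv L T
  have hZ : Measurable fun Y : Config n => fkPartition v L T Y :=
    measurable_fkSemigroup (N := n) hv L T measurable_const
  /- ### `∫ A_Q² dY = ∫_{P×P} 𝟙𝟙' crossFull` -/
  have hsq : ∫⁻ Y : Config n, blockAmp v L T j i Y ^ 2 =
      ∫⁻ pp, survInd L T pp.1 * survInd L T pp.2 *
        crossFull (n := n) v L T pp.1.1 pp.1.2 pp.2.1 pp.2.2 ∂P.prod P := by
    -- square = product integral
    have h1 : ∀ Y : Config n, blockAmp v L T j i Y ^ 2 = ∫⁻ pp, F Y pp.1 * F Y pp.2 ∂P.prod P := by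
      intro Y
      rw [hA Y, sq, lintegral_prod_mul (hFY Y).aemeasurable (hFY Y).aemeasurable]
    simp_rw [h1]
    -- swap `Y` and `pp`
    have hG' := (hF₂.comp ((measurable_fst.prodMk (measurable_fst.comp measurable_snd)) :
        Measurable fun r : Config n × (TaggedHalf × TaggedHalf) => (r.1, r.2.1))).mul
      (hF₂.comp ((measurable_fst.prodMk (measurable_snd.comp measurable_snd)) :
        Measurable fun r : Config n × (TaggedHalf × TaggedHalf) => (r.1, r.2.2)))
    have hG : Measurable fun r : Config n × (TaggedHalf × TaggedHalf) => F r.1 r.2.1 * F r.1 r.2.2 := hG'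
    rw [lintegral_lintegral_swap hG.aemeasurable]
    refine lintegral_congr fun pp => ?_
    -- inner `Y`-integral: pull the indicators out, recognise `crossFull`
    have hY : Measurable fun Y : Config n =>
        sideWeight v L T pp.1.1 Y pp.1.2 * sideWeight v L T pp.2.1 Y pp.2.2 :=
      (measurable_sideWeight_slice hv L T pp.1).mul (measurable_sideWeight_slice hv L T pp.2)
    have hc : survInd L T pp.1 * survInd L T pp.2 ≠ ⊤ :=
      ENNReal.mul_ne_top (ne_top_of_le_ne_top ENNReal.one_ne_top (survInd_le_one L T _))
        (ne_top_of_le_ne_top ENNReal.one_ne_top (survInd_le_one L T _))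
    calc ∫⁻ Y, F Y pp.1 * F Y pp.2
        = ∫⁻ Y, survInd L T pp.1 * survInd L T pp.2 *
            (sideWeight v L T pp.1.1 Y pp.1.2 * sideWeight v L T pp.2.1 Y pp.2.2) := by
          refine lintegral_congr fun Y => ?_
          simp only [hFdef]; ring
      _ = survInd L T pp.1 * survInd L T pp.2 *
            ∫⁻ Y, sideWeight v L T pp.1.1 Y pp.1.2 * sideWeight v L T pp.2.1 Y pp.2.2 :=
          lintegral_const_mul' _ _ hc
      _ = _ := by rfl
  /- ### `∫ A_Q Z_n dY = ∫_P 𝟙 crossHalf` -/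
  have hmean : meanAmp v L T j i n = ∫⁻ p, survInd L T p * crossHalf (n := n) v L T p.1 p.2 ∂P := by
    unfold meanAmp
    have h1 : ∀ Y : Config n, blockAmp v L T j i Y * fkPartition v L T Y =
        ∫⁻ p, F Y p * fkPartition v L T Y ∂P := by
      intro Y
      rw [hA Y, lintegral_mul_const _ (hFY Y)]
    simp_rw [h1]
    have hG' := hF₂.mul (hZ.comp (measurable_fst : Measurable fun q : Config n × TaggedHalf => q.1))
    have hG : Measurable fun q : Config n × TaggedHalf => F q.1 q.2 * fkPartition v L T q.1 := hG'
    rw [lintegral_lintegral_swap hG.aemeasurable]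
    refine lintegral_congr fun p => ?_
    have hY : Measurable fun Y : Config n => sideWeight v L T p.1 Y p.2 * fkPartition v L T Y :=
      (measurable_sideWeight_slice hv L T p).mul hZ
    have hc : survInd L T p ≠ ⊤ := ne_top_of_le_ne_top ENNReal.one_ne_top (survInd_le_one L T _)
    calc ∫⁻ Y, F Y p * fkPartition v L T Y
        = ∫⁻ Y, survInd L T p * (sideWeight v L T p.1 Y p.2 * fkPartition v L T Y) := by
          refine lintegral_congr fun Y => ?_
          simp only [hFdef]; ring
      _ = survInd L T p * ∫⁻ Y, sideWeight v L T p.1 Y p.2 * fkPartition v L T Y :=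
          lintegral_const_mul' _ _ hc
      _ = _ := by rfl
  /- ### integrate the four-point inequality -/
  have hS : Measurable (survInd L T) := measurable_survInd L T
  have hH : Measurable fun p : TaggedHalf => survInd L T p * crossHalf (n := n) v L T p.1 p.2 :=
    hS.mul hcH
  have hS1 : Measurable fun pp : TaggedHalf × TaggedHalf => survInd L T pp.1 := hS.comp measurable_fst
  have hS2 : Measurable fun pp : TaggedHalf × TaggedHalf => survInd L T pp.2 := hS.comp measurable_snd
  have hM1 : Measurable fun pp : TaggedHalf × TaggedHalf => survInd L T pp.1 * survInd L T pp.2 *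
      crossFull (n := n) v L T pp.1.1 pp.1.2 pp.2.1 pp.2.2 := (hS1.mul hS2).mul hcF
  have hH1 : Measurable fun pp : TaggedHalf × TaggedHalf =>
      survInd L T pp.1 * crossHalf (n := n) v L T pp.1.1 pp.1.2 := hH.comp measurable_fst
  have hH2 : Measurable fun pp : TaggedHalf × TaggedHalf =>
      survInd L T pp.2 * crossHalf (n := n) v L T pp.2.1 pp.2.2 := hH.comp measurable_snd
  have hM2 : Measurable fun pp : TaggedHalf × TaggedHalf =>
      (survInd L T pp.1 * crossHalf (n := n) v L T pp.1.1 pp.1.2) *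
        (survInd L T pp.2 * crossHalf (n := n) v L T pp.2.1 pp.2.2) := hH1.mul hH2
  calc bathTwo v L T n * ∫⁻ Y : Config n, blockAmp v L T j i Y ^ 2
      = ∫⁻ pp, survInd L T pp.1 * survInd L T pp.2 *
          (crossFull (n := n) v L T pp.1.1 pp.1.2 pp.2.1 pp.2.2 * bathTwo v L T n) ∂P.prod P := by
        rw [hsq, ← lintegral_const_mul _ hM1]
        refine lintegral_congr fun pp => ?_
        ring
    _ ≤ ∫⁻ pp, survInd L T pp.1 * survInd L T pp.2 *
          (c * (crossHalf (n := n) v L T pp.1.1 pp.1.2 * crossHalf (n := n) v L T pp.2.1 pp.2.2))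
            ∂P.prod P :=
        lintegral_mono fun pp => mul_le_mul' le_rfl (h4 _ _ _ _)
    _ = c * ∫⁻ pp, (survInd L T pp.1 * crossHalf (n := n) v L T pp.1.1 pp.1.2) *
          (survInd L T pp.2 * crossHalf (n := n) v L T pp.2.1 pp.2.2) ∂P.prod P := by
        rw [← lintegral_const_mul _ hM2]
        refine lintegral_congr fun pp => ?_
        ring
    _ = c * meanAmp v L T j i n ^ 2 := by
        rw [lintegral_prod_mul hH.aemeasurable hH.aemeasurable, hmean, sq]

end Summit.AtomisticToContinuum.BoseEinsteinCondensation.Cruxes.TwoReplicaTransienceBound.AcrossCutThinning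

end
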